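import Literature.IUT.LogVolume.DyadicPrimeResidueIsometryStable
import HarnessLib

/-!
# Isometric movers act slot by slot; at a 2-adic slot of residue degree one the isometries span exactly
# `ℤ₂·1 + {strict contractions}`, so `(R_I)^∼` is fixed by all isometries iff it is fixed by all STRICT CONTRACTIONS

Classical non-archimedean linear algebra (nothing disputed; the [IUTchIV] locator records where the abc-iut cell uses it).
abc-iut cell, seat abc-iut-E-t20 (gen 6): R-J row Y-29b, E ROWS R-26 «the right `p = 2` invariant for MIXED packets», the
RESIDUE-DEGREE-ONE half (offered as R-26b; the AMPLE half — `p` odd or `f ≥ 2`, where the isometries span all contractions and the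
invariant is abc-iut-E-t9's pure generation `(PG)` — is E-t9's R-26 file).  [IUTchIV] Prop. 1.1 p. 9: `V = ⊗_{ℚ_p, i ∈ I} k_i` over NOT
NECESSARILY EQUAL `p`-adic fields, `(R_I)^∼` its maximal `ℤ_p`-order (`normalizedPacket`).  Write `f^{[i]} := ⊗_j F_j` with `F_i = f`,
`F_j = id` (`j ≠ i`) for the single-slot action of a `ℚ_p`-linear `f : k_i → k_i` (`PiTensorProduct.map (update id i f)`, spelled out).

* §1 single-slot calculus: `(f+g)^{[i]} = f^{[i]} + g^{[i]}`, `(f∘g)^{[i]} = f^{[i]}∘g^{[i]}`, `id^{[i]} = id` (Mathlib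
  `PiTensorProduct.map_update_add`, `map_comp`), and a tuple is the composite of its slots: `⊗_i g_i = Π_i g_i^{[i]}`
  (`congr_mem_normalizedPacket_of_forall_single`: SLOT REDUCTION — `(R_I)^∼` is fixed by every factorwise-isometric tuple iff it is
  fixed by every single-slot isometry `u^{[i]}`).
* §2 at ANY slot of ANY packet: a STRICT CONTRACTION `r` (`‖r x‖ < ‖x‖`, `x ≠ 0`) is a difference of two isometries, `r = (1 + r) − 1`
  (`1 + r` is injective, hence bijective, and norm-preserving by the isosceles principle), so
  **`map_update_mem_of_strict`: single-slot isometry-stability ⟹ single-slot strict-contraction-stability.**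
* §3 at a slot whose field has RESIDUE FIELD `𝔽_2` (`hres : ‖w‖ = 1 → ‖w − 1‖ < 1`, the currency of abc-iut-E-cx-2/E-t47's residual
  class; every totally ramified 2-adic field, and `ℚ_2`): every isometry `u` is `1 +` a strict contraction (`norm_sub_lt_of_isometry`), so
  **`map_update_mem_of_isometry_of_hres`: strict-contraction-stability ⟹ isometry-stability**, and the two are EQUIVALENT
  (`single_isometry_stable_iff_strict_of_hres`).  The `ℤ_2`-span of the isometries is `ℤ_2·1 + {strict contractions}` — it contains
  NO coordinate idempotent (every isometry is `≡ 1` on each graded piece `π^m𝒪/π^{m+1}𝒪 ≅ 𝔽_2`), which is why E-t9's `(PG)` fails at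
  `ℚ_2(√−1) ⊗ ℚ_2(√−1)` (p492001) although that packet is stable.
* §4 THE `p = 2` INVARIANT at residue degree one (`congr_image_normalizedPacket_eq_iff_strict`,
  `exists_isometry_mover_iff_exists_strict_mover`): for a MIXED packet all of whose slots satisfy `hres`,
  **«`(R_I)^∼` is fixed by every factorwise-isometric tuple ⟺ `r^{[i]}((R_I)^∼) ⊆ (R_I)^∼` for every slot `i` and every strict
  contraction `r` of `k_i`»** — i.e. `(R_I)^∼` is a module over `⊗_i (ℤ_2·1 + rad End_{≤1}(k_i))`; and the mixed p-UNIFORM form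
  (`congr_image_normalizedPacket_eq_of_slotwise`): isometry-stability at the other slots ∧ strict-contraction-stability at the
  `hres` slots ⟹ tuple-stability.
* §5 finite check (`strict_stable_iff_elementary`): in a norm-dominated basis `b` of `k_i` (E-t42's `TameDualPair.exists_dominated_basis`)
  the strict contractions are the `ℤ_2`-combinations of the ELEMENTARY ones `x ↦ c·x_{m'}·b_m` with `‖c‖·‖b_m‖ < ‖b_{m'}‖`; so at an `hres`
  slot, isometry-stability ⟺ stability under these finitely many elementary maps (up to `ℤ_2`-multiples) — on the DIAGONAL only
  `‖c‖ < 1`: `2E_mm`, never `E_mm`.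

CONTAINERS only; no side taken on [IUTchIII] Cor. 3.12 / [IUTchIV] Thm. 1.10 or on any author.  PROOF-ONLY file (no definition,
no `Prop` fact, no `sorry`). [cite: Mochizuki2012, IUTchIV Prop. 1.1 p. 9] [cite: WeilBNT1967, Ch. II §1, Prop. 3]
[cite: SerreLocalFields1979, Ch. III §3, Prop. 7]
-/

noncomputable section

open Module Function
open scoped TensorProduct

namespace Literature.IUT.LogVolume

namespace StrictContraction

variable (p : ℕ) [hp : Fact p.Prime] {I : Type} [Fintype I] [DecidableEq I]
  (k : I → Type) [∀ i, NontriviallyNormedField (k i)] [∀ i, NormedAlgebra ℚ_[p] (k i)]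
  [∀ i, IsUltrametricDist (k i)] [∀ i, ProperSpace (k i)]

/-! ## §1 Single-slot calculus and slot reduction -/

omit [Fintype I] [∀ i, IsUltrametricDist (k i)] [∀ i, ProperSpace (k i)] in
/-- `(f + g)^{[i]} = f^{[i]} + g^{[i]}` (multilinearity of `⊗` in the `i`-th slot, Mathlib `PiTensorProduct.map_update_add`).
[cite: Mochizuki2012, IUTchIV Prop. 1.1 p. 9] -/
theorem map_update_add (i : I) (f g : k i →ₗ[ℚ_[p]] k i) :
    (PiTensorProduct.map (update (fun j => (LinearMap.id : k j →ₗ[ℚ_[p]] k j)) i (f + g)) :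
        PacketAlgebra p k →ₗ[ℚ_[p]] PacketAlgebra p k) =
      PiTensorProduct.map (update (fun j => (LinearMap.id : k j →ₗ[ℚ_[p]] k j)) i f) +
        PiTensorProduct.map (update (fun j => (LinearMap.id : k j →ₗ[ℚ_[p]] k j)) i g) :=
  PiTensorProduct.map_update_add _ i f g

omit [Fintype I] [∀ i, IsUltrametricDist (k i)] [∀ i, ProperSpace (k i)] in
/-- `id^{[i]} = id`. [cite: Mochizuki2012, IUTchIV Prop. 1.1 p. 9] -/
theorem map_update_id (i : I) :
    (PiTensorProduct.map (update (fun j => (LinearMap.id : k j →ₗ[ℚ_[p]] k j)) i LinearMap.id) :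
        PacketAlgebra p k →ₗ[ℚ_[p]] PacketAlgebra p k) = LinearMap.id := by
  rw [update_eq_self, PiTensorProduct.map_id]

omit [Fintype I] [∀ i, IsUltrametricDist (k i)] [∀ i, ProperSpace (k i)] in
/-- `(f ∘ g)^{[i]} = f^{[i]} ∘ g^{[i]}` (Mathlib `PiTensorProduct.map_comp`, the updates composing slotwise).
[cite: Mochizuki2012, IUTchIV Prop. 1.1 p. 9] -/
theorem map_update_comp (i : I) (f g : k i →ₗ[ℚ_[p]] k i) :
    (PiTensorProduct.map (update (fun j => (LinearMap.id : k j →ₗ[ℚ_[p]] k j)) i (f ∘ₗ g)) :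
        PacketAlgebra p k →ₗ[ℚ_[p]] PacketAlgebra p k) =
      PiTensorProduct.map (update (fun j => (LinearMap.id : k j →ₗ[ℚ_[p]] k j)) i f) ∘ₗ
        PiTensorProduct.map (update (fun j => (LinearMap.id : k j →ₗ[ℚ_[p]] k j)) i g) := by
  rw [← PiTensorProduct.map_comp]
  congr 1
  funext j
  by_cases hj : j = i
  · subst hj; simp
  · simp [update_of_ne hj]

omit [Fintype I] [∀ i, IsUltrametricDist (k i)] [∀ i, ProperSpace (k i)] in
/-- **A tuple is the composite of its slots**: for `g_i : k_i ≃ k_i` and a finite set `s` of slots, `⊗ (g on s, id off s)` maps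
`(R_I)^∼` into itself as soon as every single slot `g_i^{[i]}` (`i ∈ s`) does (induction on `s`: `⊗(g on s ∪ {a}) =
g_a^{[a]} ∘ ⊗(g on s)`). [cite: Mochizuki2012, IUTchIV Prop. 1.1 p. 9] -/
theorem map_piecewise_mem_normalizedPacket (g : ∀ i, k i ≃ₗ[ℚ_[p]] k i)
    (hg : ∀ i, ∀ z ∈ normalizedPacket p k,
      PiTensorProduct.map (update (fun j => (LinearMap.id : k j →ₗ[ℚ_[p]] k j)) i (g i : k i →ₗ[ℚ_[p]] k i)) z ∈
        normalizedPacket p k)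
    (s : Finset I) : ∀ z ∈ normalizedPacket p k,
      PiTensorProduct.map (fun j => if j ∈ s then (g j : k j →ₗ[ℚ_[p]] k j) else LinearMap.id) z ∈ normalizedPacket p k := by
  classical
  induction s using Finset.induction_on with
  | empty => intro z hz; simpa [PiTensorProduct.map_id] using hz
  | @insert a s ha ih =>
    intro z hz
    have hfun : (fun j => if j ∈ insert a s then (g j : k j →ₗ[ℚ_[p]] k j) else LinearMap.id) =
        fun j => (update (fun j => (LinearMap.id : k j →ₗ[ℚ_[p]] k j)) a (g a : k a →ₗ[ℚ_[p]] k a) j) ∘ₗ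
          (if j ∈ s then (g j : k j →ₗ[ℚ_[p]] k j) else LinearMap.id) := by
      funext j
      by_cases hj : j = a
      · subst hj; simp [ha]
      · simp [hj]
    rw [hfun, PiTensorProduct.map_comp, LinearMap.comp_apply]
    exact hg a _ (ih z hz)

omit [∀ i, IsUltrametricDist (k i)] [∀ i, ProperSpace (k i)] in
/-- **SLOT REDUCTION (⟸)**: if every single-slot ISOMETRY `u^{[i]}` maps `(R_I)^∼` into itself (every slot `i`, every `ℚ_p`-linear
isometry `u` of `k_i`), then every factorwise-isometric tuple does. [cite: Mochizuki2012, IUTchIV Prop. 1.1 p. 9] -/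
theorem congr_mem_normalizedPacket_of_forall_single
    (h : ∀ (i : I) (u : k i ≃ₗ[ℚ_[p]] k i), (∀ x, ‖u x‖ = ‖x‖) → ∀ z ∈ normalizedPacket p k,
      PiTensorProduct.map (update (fun j => (LinearMap.id : k j →ₗ[ℚ_[p]] k j)) i (u : k i →ₗ[ℚ_[p]] k i)) z ∈
        normalizedPacket p k)
    (g : ∀ i, k i ≃ₗ[ℚ_[p]] k i) (hg : ∀ i x, ‖g i x‖ = ‖x‖) {z : PacketAlgebra p k} (hz : z ∈ normalizedPacket p k) :
    (PiTensorProduct.congr g : PacketAlgebra p k ≃ₗ[ℚ_[p]] PacketAlgebra p k) z ∈ normalizedPacket p k := by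
  classical
  have h' := map_piecewise_mem_normalizedPacket p k g (fun i => h i (g i) (hg i)) Finset.univ z hz
  simp only [Finset.mem_univ, if_true] at h'
  exact h'

omit [∀ i, IsUltrametricDist (k i)] [∀ i, ProperSpace (k i)] in
/-- … with equality `(⊗ g_i)((R_I)^∼) = (R_I)^∼` (apply the inclusion to `g` and to `g⁻¹`). [cite: Mochizuki2012, IUTchIV Prop. 1.1 p. 9] -/
theorem congr_image_normalizedPacket_eq_of_forall_single
    (h : ∀ (i : I) (u : k i ≃ₗ[ℚ_[p]] k i), (∀ x, ‖u x‖ = ‖x‖) → ∀ z ∈ normalizedPacket p k,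
      PiTensorProduct.map (update (fun j => (LinearMap.id : k j →ₗ[ℚ_[p]] k j)) i (u : k i →ₗ[ℚ_[p]] k i)) z ∈
        normalizedPacket p k)
    (g : ∀ i, k i ≃ₗ[ℚ_[p]] k i) (hg : ∀ i x, ‖g i x‖ = ‖x‖) :
    (PiTensorProduct.congr g : PacketAlgebra p k ≃ₗ[ℚ_[p]] PacketAlgebra p k) ''
        (normalizedPacket p k : Set (PacketAlgebra p k)) = normalizedPacket p k := by
  have hg' : ∀ i x, ‖(g i).symm x‖ = ‖x‖ := fun i x => by rw [← hg i ((g i).symm x), LinearEquiv.apply_symm_apply]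
  refine Set.Subset.antisymm (by rintro _ ⟨z, hz, rfl⟩; exact congr_mem_normalizedPacket_of_forall_single p k h g hg hz)
    fun z hz => ⟨_, ?_, LinearEquiv.apply_symm_apply _ z⟩
  change (PiTensorProduct.congr (fun i => (g i).symm) : PacketAlgebra p k ≃ₗ[ℚ_[p]] PacketAlgebra p k) z ∈ _
  exact congr_mem_normalizedPacket_of_forall_single p k h (fun i => (g i).symm) hg' hz

omit [Fintype I] [∀ i, IsUltrametricDist (k i)] [∀ i, ProperSpace (k i)] in
/-- **SLOT REDUCTION (⟹)**: a single-slot isometry IS a factorwise-isometric tuple (identity at the other slots), so tuple-stability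
gives single-slot stability. [cite: Mochizuki2012, IUTchIV Prop. 1.1 p. 9] -/
theorem map_update_mem_of_forall_congr
    (h : ∀ (g : ∀ i, k i ≃ₗ[ℚ_[p]] k i), (∀ i x, ‖g i x‖ = ‖x‖) → ∀ z ∈ normalizedPacket p k,
      (PiTensorProduct.congr g : PacketAlgebra p k ≃ₗ[ℚ_[p]] PacketAlgebra p k) z ∈ normalizedPacket p k)
    (i : I) (u : k i ≃ₗ[ℚ_[p]] k i) (hu : ∀ x, ‖u x‖ = ‖x‖) {z : PacketAlgebra p k} (hz : z ∈ normalizedPacket p k) :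
    PiTensorProduct.map (update (fun j => (LinearMap.id : k j →ₗ[ℚ_[p]] k j)) i (u : k i →ₗ[ℚ_[p]] k i)) z ∈
      normalizedPacket p k := by
  have hiso : ∀ j x, ‖update (fun j => LinearEquiv.refl ℚ_[p] (k j)) i u j x‖ = ‖x‖ := by
    intro j x
    by_cases hj : j = i
    · subst hj; simp [hu]
    · simp [update_of_ne hj]
  have hfun : (fun j => (update (fun j => LinearEquiv.refl ℚ_[p] (k j)) i u j : k j →ₗ[ℚ_[p]] k j)) =
      update (fun j => (LinearMap.id : k j →ₗ[ℚ_[p]] k j)) i (u : k i →ₗ[ℚ_[p]] k i) := by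
    funext j
    by_cases hj : j = i
    · subst hj; simp
    · simp [update_of_ne hj]
  have h' := h _ hiso z hz
  change PiTensorProduct.map (fun j => (update (fun j => LinearEquiv.refl ℚ_[p] (k j)) i u j : k j →ₗ[ℚ_[p]] k j)) z ∈ _ at h'
  rwa [hfun] at h'

/-! ## §2 Strict contractions are differences of isometries (any slot, any `p`) -/

section Slot

variable {p} {K : Type} [NontriviallyNormedField K] [NormedAlgebra ℚ_[p] K] [IsUltrametricDist K] [ProperSpace K]

/-- **`1 + r` is an isometry for a strict contraction `r`** (`‖x + r x‖ = ‖x‖` since `‖r x‖ < ‖x‖`: all triangles are isosceles);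
it is a linear automorphism because it is injective on a finite-dimensional space. [cite: WeilBNT1967, Ch. II §1, Prop. 3] -/
theorem exists_isometry_one_add_of_strict (r : K →ₗ[ℚ_[p]] K) (hr : ∀ x, x ≠ 0 → ‖r x‖ < ‖x‖) :
    ∃ u : K ≃ₗ[ℚ_[p]] K, (∀ x, ‖u x‖ = ‖x‖) ∧ (u : K →ₗ[ℚ_[p]] K) = LinearMap.id + r := by
  haveI := finiteDimensional p K
  have hnorm : ∀ x, ‖(LinearMap.id + r : K →ₗ[ℚ_[p]] K) x‖ = ‖x‖ := fun x => by
    by_cases hx : x = 0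
    · simp [hx]
    · rw [LinearMap.add_apply, LinearMap.id_apply,
        IsUltrametricDist.norm_add_eq_max_of_norm_ne_norm (hr x hx).ne', max_eq_left (hr x hx).le]
  have hinj : Function.Injective (LinearMap.id + r : K →ₗ[ℚ_[p]] K) := fun x y hxy => by
    have h : (LinearMap.id + r : K →ₗ[ℚ_[p]] K) (x - y) = 0 := by rw [map_sub, hxy, sub_self]
    have h2 : ‖x - y‖ = 0 := by rw [← hnorm, h, norm_zero]
    exact sub_eq_zero.mp (norm_eq_zero.mp h2)
  exact ⟨LinearEquiv.ofInjectiveEndo _ hinj, hnorm, rfl⟩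

end Slot

omit [Fintype I] in
/-- **Isometry-stable at slot `i` ⟹ STRICT-CONTRACTION-stable at slot `i`** (any `p`, any slot field): if every single-slot isometry
`u^{[i]}` maps `(R_I)^∼` into itself then so does `r^{[i]}` for every strict contraction `r` of `k_i`, since
`r^{[i]} = (1 + r)^{[i]} − id`. [cite: Mochizuki2012, IUTchIV Prop. 1.1 p. 9] [cite: WeilBNT1967, Ch. II §1, Prop. 3] -/
theorem map_update_mem_of_strict (i : I)
    (h : ∀ u : k i ≃ₗ[ℚ_[p]] k i, (∀ x, ‖u x‖ = ‖x‖) → ∀ z ∈ normalizedPacket p k,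
      PiTensorProduct.map (update (fun j => (LinearMap.id : k j →ₗ[ℚ_[p]] k j)) i (u : k i →ₗ[ℚ_[p]] k i)) z ∈
        normalizedPacket p k)
    (r : k i →ₗ[ℚ_[p]] k i) (hr : ∀ x, x ≠ 0 → ‖r x‖ < ‖x‖) {z : PacketAlgebra p k} (hz : z ∈ normalizedPacket p k) :
    PiTensorProduct.map (update (fun j => (LinearMap.id : k j →ₗ[ℚ_[p]] k j)) i r) z ∈ normalizedPacket p k := by
  obtain ⟨u, hu, hur⟩ := exists_isometry_one_add_of_strict r hr
  have hdec : PiTensorProduct.map (update (fun j => (LinearMap.id : k j →ₗ[ℚ_[p]] k j)) i r) z =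
      PiTensorProduct.map (update (fun j => (LinearMap.id : k j →ₗ[ℚ_[p]] k j)) i (u : k i →ₗ[ℚ_[p]] k i)) z - z := by
    rw [hur, map_update_add, map_update_id, LinearMap.add_apply, LinearMap.id_apply, add_sub_cancel_left]
  rw [hdec]
  exact sub_mem (h u hu z hz) hz

/-! ## §3 Residue field `𝔽₂`: isometries are `1 +` strict contractions -/

omit [Fintype I] [∀ i, IsUltrametricDist (k i)] [∀ i, ProperSpace (k i)] in
/-- **Strict-contraction-stable at slot `i` ⟹ isometry-stable at slot `i`, when `k_i` has residue field `𝔽_2`** (`hres`): every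
isometry `u` of `k_i` has `‖u x − x‖ < ‖x‖` (abc-iut-E-t47/E-cx-2's `norm_sub_lt_of_isometry`), so `u^{[i]} = id + (u − 1)^{[i]}` with
`u − 1` a strict contraction. [cite: SerreLocalFields1979, Ch. III §3, Prop. 7] [cite: Mochizuki2012, IUTchIV Prop. 1.1 p. 9] -/
theorem map_update_mem_of_isometry_of_hres (i : I) (hres : ∀ w : k i, ‖w‖ = 1 → ‖w - 1‖ < 1)
    (h : ∀ r : k i →ₗ[ℚ_[p]] k i, (∀ x, x ≠ 0 → ‖r x‖ < ‖x‖) → ∀ z ∈ normalizedPacket p k,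
      PiTensorProduct.map (update (fun j => (LinearMap.id : k j →ₗ[ℚ_[p]] k j)) i r) z ∈ normalizedPacket p k)
    (u : k i ≃ₗ[ℚ_[p]] k i) (hu : ∀ x, ‖u x‖ = ‖x‖) {z : PacketAlgebra p k} (hz : z ∈ normalizedPacket p k) :
    PiTensorProduct.map (update (fun j => (LinearMap.id : k j →ₗ[ℚ_[p]] k j)) i (u : k i →ₗ[ℚ_[p]] k i)) z ∈
      normalizedPacket p k := by
  have hstrict : ∀ x : k i, x ≠ 0 → ‖(((u : k i →ₗ[ℚ_[p]] k i) - LinearMap.id : k i →ₗ[ℚ_[p]] k i)) x‖ < ‖x‖ :=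
    fun x hx => by
    rw [LinearMap.sub_apply, LinearMap.id_apply]
    exact DyadicPrimeResidue.norm_sub_lt_of_isometry hres u hu hx
  have hdec : PiTensorProduct.map (update (fun j => (LinearMap.id : k j →ₗ[ℚ_[p]] k j)) i (u : k i →ₗ[ℚ_[p]] k i)) z =
      z + PiTensorProduct.map (update (fun j => (LinearMap.id : k j →ₗ[ℚ_[p]] k j)) i
        ((u : k i →ₗ[ℚ_[p]] k i) - LinearMap.id)) z := by
    conv_lhs => rw [show (u : k i →ₗ[ℚ_[p]] k i) = LinearMap.id + ((u : k i →ₗ[ℚ_[p]] k i) - LinearMap.id) by abel]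
    rw [map_update_add, map_update_id, LinearMap.add_apply, LinearMap.id_apply]
  rw [hdec]
  exact add_mem hz (h _ hstrict z hz)

omit [Fintype I] in
/-- **At a slot with residue field `𝔽_2`: single-slot isometry-stability ⟺ single-slot STRICT-contraction-stability** (§2 + §3).
The `ℤ_2`-span of the isometries is `ℤ_2·1 + {strict contractions}`; no coordinate idempotent lies in it.
[cite: SerreLocalFields1979, Ch. III §3, Prop. 7] [cite: Mochizuki2012, IUTchIV Prop. 1.1 p. 9] -/
theorem single_isometry_stable_iff_strict_of_hres (i : I) (hres : ∀ w : k i, ‖w‖ = 1 → ‖w - 1‖ < 1) :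
    (∀ u : k i ≃ₗ[ℚ_[p]] k i, (∀ x, ‖u x‖ = ‖x‖) → ∀ z ∈ normalizedPacket p k,
      PiTensorProduct.map (update (fun j => (LinearMap.id : k j →ₗ[ℚ_[p]] k j)) i (u : k i →ₗ[ℚ_[p]] k i)) z ∈
        normalizedPacket p k) ↔
    (∀ r : k i →ₗ[ℚ_[p]] k i, (∀ x, x ≠ 0 → ‖r x‖ < ‖x‖) → ∀ z ∈ normalizedPacket p k,
      PiTensorProduct.map (update (fun j => (LinearMap.id : k j →ₗ[ℚ_[p]] k j)) i r) z ∈ normalizedPacket p k) :=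
  ⟨fun h r hr _ hz => map_update_mem_of_strict p k i h r hr hz,
    fun h u hu _ hz => map_update_mem_of_isometry_of_hres p k i hres h u hu hz⟩

/-! ## §4 The invariant: tuples -/

omit [∀ i, IsUltrametricDist (k i)] [∀ i, ProperSpace (k i)] in
/-- **MIXED, `p`-uniform form.**  If at every slot EITHER every single-slot isometry maps `(R_I)^∼` into itself, OR the slot field has
residue field `𝔽_2` and every single-slot strict contraction maps `(R_I)^∼` into itself, then EVERY factorwise-isometric tuple fixes
`(R_I)^∼`.  (At the AMPLE slots — `p` odd or `f ≥ 2` — the first alternative is abc-iut-E-t9's pure-tensor criterion; this file supplies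
the residue-degree-one slots.) [cite: Mochizuki2012, IUTchIV Prop. 1.1 p. 9] -/
theorem congr_image_normalizedPacket_eq_of_slotwise
    (h : ∀ i : I, (∀ u : k i ≃ₗ[ℚ_[p]] k i, (∀ x, ‖u x‖ = ‖x‖) → ∀ z ∈ normalizedPacket p k,
        PiTensorProduct.map (update (fun j => (LinearMap.id : k j →ₗ[ℚ_[p]] k j)) i (u : k i →ₗ[ℚ_[p]] k i)) z ∈
          normalizedPacket p k) ∨
      ((∀ w : k i, ‖w‖ = 1 → ‖w - 1‖ < 1) ∧ ∀ r : k i →ₗ[ℚ_[p]] k i, (∀ x, x ≠ 0 → ‖r x‖ < ‖x‖) →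
        ∀ z ∈ normalizedPacket p k,
          PiTensorProduct.map (update (fun j => (LinearMap.id : k j →ₗ[ℚ_[p]] k j)) i r) z ∈ normalizedPacket p k))
    (g : ∀ i, k i ≃ₗ[ℚ_[p]] k i) (hg : ∀ i x, ‖g i x‖ = ‖x‖) :
    (PiTensorProduct.congr g : PacketAlgebra p k ≃ₗ[ℚ_[p]] PacketAlgebra p k) ''
        (normalizedPacket p k : Set (PacketAlgebra p k)) = normalizedPacket p k := by
  refine congr_image_normalizedPacket_eq_of_forall_single p k (fun i u hu z hz => ?_) g hg
  rcases h i with h1 | ⟨hres, h2⟩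
  · exact h1 u hu z hz
  · exact map_update_mem_of_isometry_of_hres p k i hres h2 u hu hz

/-- **THE `p = 2` INVARIANT AT RESIDUE DEGREE ONE.**  For a MIXED packet all of whose slot fields have residue field `𝔽_2` (e.g. any
family of totally ramified 2-adic fields, `ℚ_2` allowed): `(R_I)^∼` is fixed by EVERY factorwise-isometric tuple **iff** for every slot
`i` and every STRICT CONTRACTION `r` of `k_i`, `r^{[i]}((R_I)^∼) ⊆ (R_I)^∼` — `(R_I)^∼` is a module over `⊗_i (ℤ_2·1 + {strict
contractions of k_i})`.  This replaces abc-iut-E-t9's `(PG)` (false here: `ℚ_2(√−1) ⊗ ℚ_2(√−1)`, p492001) at such packets.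
[cite: Mochizuki2012, IUTchIV Prop. 1.1 p. 9] [cite: SerreLocalFields1979, Ch. III §3, Prop. 7] -/
theorem congr_image_normalizedPacket_eq_iff_strict (hres : ∀ (i : I) (w : k i), ‖w‖ = 1 → ‖w - 1‖ < 1) :
    (∀ g : ∀ i, k i ≃ₗ[ℚ_[p]] k i, (∀ i x, ‖g i x‖ = ‖x‖) →
      (PiTensorProduct.congr g : PacketAlgebra p k ≃ₗ[ℚ_[p]] PacketAlgebra p k) ''
        (normalizedPacket p k : Set (PacketAlgebra p k)) = normalizedPacket p k) ↔
    (∀ (i : I) (r : k i →ₗ[ℚ_[p]] k i), (∀ x, x ≠ 0 → ‖r x‖ < ‖x‖) → ∀ z ∈ normalizedPacket p k,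
      PiTensorProduct.map (update (fun j => (LinearMap.id : k j →ₗ[ℚ_[p]] k j)) i r) z ∈ normalizedPacket p k) := by
  constructor
  · intro h i r hr z hz
    refine map_update_mem_of_strict p k i (fun u hu w hw => ?_) r hr hz
    refine map_update_mem_of_forall_congr p k (fun g hg v hv => ?_) i u hu hw
    have hmem := Set.mem_image_of_mem (PiTensorProduct.congr g : PacketAlgebra p k ≃ₗ[ℚ_[p]] PacketAlgebra p k) hv
    rw [h g hg] at hmem
    exact hmem
  · intro h g hg
    exact congr_image_normalizedPacket_eq_of_slotwise p k (fun i => Or.inr ⟨hres i, h i⟩) g hg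

/-- **Mover form**: at such a packet, a factorwise-isometric MOVER of `(R_I)^∼` exists iff some single-slot STRICT CONTRACTION moves
`(R_I)^∼`. [cite: Mochizuki2012, IUTchIV Prop. 1.1 p. 9] -/
theorem exists_isometry_mover_iff_exists_strict_mover (hres : ∀ (i : I) (w : k i), ‖w‖ = 1 → ‖w - 1‖ < 1) :
    (∃ (g : ∀ i, k i ≃ₗ[ℚ_[p]] k i) (_ : ∀ i x, ‖g i x‖ = ‖x‖) (z : PacketAlgebra p k), z ∈ normalizedPacket p k ∧
        (PiTensorProduct.congr g : PacketAlgebra p k ≃ₗ[ℚ_[p]] PacketAlgebra p k) z ∉ normalizedPacket p k) ↔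
    ∃ (i : I) (r : k i →ₗ[ℚ_[p]] k i) (_ : ∀ x, x ≠ 0 → ‖r x‖ < ‖x‖) (z : PacketAlgebra p k), z ∈ normalizedPacket p k ∧
        PiTensorProduct.map (update (fun j => (LinearMap.id : k j →ₗ[ℚ_[p]] k j)) i r) z ∉ normalizedPacket p k := by
  have key := congr_image_normalizedPacket_eq_iff_strict p k hres
  constructor
  · rintro ⟨g, hg, z, hz, hmv⟩
    by_contra hne
    push Not at hne
    have hall : ∀ (i : I) (r : k i →ₗ[ℚ_[p]] k i), (∀ x, x ≠ 0 → ‖r x‖ < ‖x‖) → ∀ z ∈ normalizedPacket p k,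
        PiTensorProduct.map (update (fun j => (LinearMap.id : k j →ₗ[ℚ_[p]] k j)) i r) z ∈ normalizedPacket p k :=
      fun i r hr z hz => hne i r hr z hz
    have hmem := Set.mem_image_of_mem (PiTensorProduct.congr g : PacketAlgebra p k ≃ₗ[ℚ_[p]] PacketAlgebra p k) hz
    rw [key.mpr hall g hg] at hmem
    exact hmv hmem
  · rintro ⟨i, r, hr, z, hz, hmv⟩
    by_contra hne
    push Not at hne
    have hall : ∀ g : ∀ i, k i ≃ₗ[ℚ_[p]] k i, (∀ i x, ‖g i x‖ = ‖x‖) →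
        (PiTensorProduct.congr g : PacketAlgebra p k ≃ₗ[ℚ_[p]] PacketAlgebra p k) ''
          (normalizedPacket p k : Set (PacketAlgebra p k)) = normalizedPacket p k := by
      intro g hg
      have hg' : ∀ i x, ‖(g i).symm x‖ = ‖x‖ := fun i x => by rw [← hg i ((g i).symm x), LinearEquiv.apply_symm_apply]
      refine Set.Subset.antisymm (by rintro _ ⟨w, hw, rfl⟩; exact hne g hg w hw) fun w hw => ⟨_, ?_, LinearEquiv.apply_symm_apply _ w⟩
      exact hne (fun i => (g i).symm) hg' w hw
    exact hmv (key.mp hall i r hr z hz)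

/-! ## §5 The finite check: elementary strict contractions in a norm-dominated basis -/

section Elementary

variable {p} {K : Type} [NontriviallyNormedField K] [NormedAlgebra ℚ_[p] K] [IsUltrametricDist K] [ProperSpace K]
variable {κ : Type} [Fintype κ] (b : Basis κ ℚ_[p] K) (hb : ∀ (x : K) (m : κ), ‖b.repr x m • b m‖ ≤ ‖x‖)
include hb

omit [IsUltrametricDist K] [ProperSpace K] [Fintype κ] in
/-- In a norm-DOMINATED basis (`‖x_m b_m‖ ≤ ‖x‖`, E-t42's `TameDualPair.exists_dominated_basis`), the ELEMENTARY map
`x ↦ c·x_{m'}·b_m` with `‖c‖·‖b_m‖ < ‖b_{m'}‖` is a strict contraction. [cite: WeilBNT1967, Ch. II §1, Prop. 3] -/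
theorem elementary_strict (m m' : κ) (c : ℚ_[p]) (hc : ‖c‖ * ‖b m‖ < ‖b m'‖) (x : K) (hx : x ≠ 0) :
    ‖(c • (LinearMap.toSpanSingleton ℚ_[p] K (b m) ∘ₗ b.coord m')) x‖ < ‖x‖ := by
  rw [LinearMap.smul_apply, LinearMap.comp_apply, LinearMap.toSpanSingleton_apply, Basis.coord_apply, smul_smul, norm_smul,
    norm_mul]
  by_cases h0 : b.repr x m' = 0
  · rw [h0, norm_zero, mul_zero, zero_mul]; exact norm_pos_iff.mpr hx
  · have h1 : ‖b.repr x m'‖ * ‖b m'‖ ≤ ‖x‖ := by rw [← norm_smul]; exact hb x m'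
    calc ‖c‖ * ‖b.repr x m'‖ * ‖b m‖ = ‖b.repr x m'‖ * (‖c‖ * ‖b m‖) := by ring
      _ < ‖b.repr x m'‖ * ‖b m'‖ := mul_lt_mul_of_pos_left hc (norm_pos_iff.mpr h0)
      _ ≤ ‖x‖ := h1

omit [IsUltrametricDist K] [ProperSpace K] hb in
/-- Conversely every `ℚ_p`-linear `r` is a finite sum of elementary maps (and for a strict contraction the coefficients are strict): `r = Σ_{m,m'} r_{mm'} E_{mm'}` with
`r_{mm'} = (r b_{m'})_m` and `‖r_{mm'}‖·‖b_m‖ ≤ ‖r b_{m'}‖ < ‖b_{m'}‖` (domination). [cite: WeilBNT1967, Ch. II §1, Prop. 3] -/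
theorem eq_sum_elementary (r : K →ₗ[ℚ_[p]] K) :
    r = ∑ m, ∑ m', b.repr (r (b m')) m • (LinearMap.toSpanSingleton ℚ_[p] K (b m) ∘ₗ b.coord m') := by
  classical
  refine b.ext fun m₀ => ?_
  simp only [LinearMap.sum_apply, LinearMap.smul_apply, LinearMap.comp_apply, LinearMap.toSpanSingleton_apply,
    Basis.coord_apply, Basis.repr_self, Finsupp.single_apply]
  rw [Finset.sum_comm, Finset.sum_eq_single m₀ (fun m' _ hm' => by simp [Ne.symm hm']) (fun h => absurd (Finset.mem_univ m₀) h)]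
  simp only [if_true, one_smul]
  exact (b.sum_repr (r (b m₀))).symm

end Elementary

omit [Fintype I] in
/-- **THE FINITE CHECK at a residue-degree-one slot.**  With a norm-dominated basis `b` of `k_i`: single-slot isometry-stability of
`(R_I)^∼` at `i` ⟺ `(c·E_{mm'})^{[i]}((R_I)^∼) ⊆ (R_I)^∼` for all `m, m'` and `c` with `‖c‖·‖b_m‖ < ‖b_{m'}‖` (`E_{mm'} x = x_{m'}·b_m`).  On the
diagonal this asks for `2E_mm`, not `E_mm` — the located difference from abc-iut-E-t9's pure generation at `ℚ_2(√−1)⊗ℚ_2(√−1)`.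
[cite: Mochizuki2012, IUTchIV Prop. 1.1 p. 9] [cite: WeilBNT1967, Ch. II §1, Prop. 3] -/
theorem single_isometry_stable_iff_elementary (i : I) (hres : ∀ w : k i, ‖w‖ = 1 → ‖w - 1‖ < 1)
    {κ : Type} [Fintype κ] (b : Basis κ ℚ_[p] (k i)) (hb : ∀ (x : k i) (m : κ), ‖b.repr x m • b m‖ ≤ ‖x‖) :
    (∀ u : k i ≃ₗ[ℚ_[p]] k i, (∀ x, ‖u x‖ = ‖x‖) → ∀ z ∈ normalizedPacket p k,
      PiTensorProduct.map (update (fun j => (LinearMap.id : k j →ₗ[ℚ_[p]] k j)) i (u : k i →ₗ[ℚ_[p]] k i)) z ∈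
        normalizedPacket p k) ↔
    (∀ (m m' : κ) (c : ℚ_[p]), ‖c‖ * ‖b m‖ < ‖b m'‖ → ∀ z ∈ normalizedPacket p k,
      PiTensorProduct.map (update (fun j => (LinearMap.id : k j →ₗ[ℚ_[p]] k j)) i
        (c • (LinearMap.toSpanSingleton ℚ_[p] (k i) (b m) ∘ₗ b.coord m'))) z ∈ normalizedPacket p k) := by
  classical
  rw [single_isometry_stable_iff_strict_of_hres p k i hres]
  refine ⟨fun h m m' c hc z hz => h _ (elementary_strict b hb m m' c hc) z hz, fun h r hr z hz => ?_⟩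
  -- expand `r` in elementary maps; each coefficient is strict by domination
  let L : (k i →ₗ[ℚ_[p]] k i) →ₗ[ℚ_[p]] (PacketAlgebra p k →ₗ[ℚ_[p]] PacketAlgebra p k) :=
    (PiTensorProduct.mapMultilinear ℚ_[p] k k).toLinearMap (fun j => (LinearMap.id : k j →ₗ[ℚ_[p]] k j)) i
  have hL : ∀ f : k i →ₗ[ℚ_[p]] k i, L f = PiTensorProduct.map (update (fun j => (LinearMap.id : k j →ₗ[ℚ_[p]] k j)) i f) :=
    fun f => rfl
  rw [← hL, eq_sum_elementary b r, map_sum]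
  simp_rw [map_sum, map_smul, LinearMap.sum_apply, LinearMap.smul_apply, hL]
  refine sum_mem fun m _ => sum_mem fun m' _ => ?_
  -- `‖r_{mm'}‖·‖b_m‖ ≤ ‖r b_{m'}‖ < ‖b_{m'}‖`: each term is an allowed elementary map
  have hlt : ‖b.repr (r (b m')) m‖ * ‖b m‖ < ‖b m'‖ := by
    rw [← norm_smul]
    exact (hb (r (b m')) m).trans_lt (hr (b m') (b.ne_zero m'))
  have h1 := h m m' (b.repr (r (b m')) m) hlt z hz
  rw [← hL, map_smul, LinearMap.smul_apply] at h1
  exact h1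

end StrictContraction

end Literature.IUT.LogVolume

end
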